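import Summits.SmoothPoincare4.SmoothPoincare4.Theses.EntropyRung
import Summits.SmoothPoincare4.SmoothPoincare4.Theorems.EntropyRungCompactShrinkerGapScalarIdentities
import Summits.SmoothPoincare4.SmoothPoincare4.Theorems.EntropyRungCompactShrinkerGapScalarCurvaturePos
import Literature.Topology.FourManifolds.HomotopyS4SimplyConnected
import Literature.Topology.FourManifolds.SphereSimplyConnected
import HarnessLib

/-!
# Route EntropyRung — the glue item `CompactGapOfChangGurskyYang` reduced to the Weyl budget

Item stmt-SmoothPoincare4-14743 is the implication
`CompactGapOfChangGurskyYang : ChangGurskyYang → CompactShrinkerGap` between two decls of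
`Summits/SmoothPoincare4/SmoothPoincare4/Theses/EntropyRung.lean`.

This file records, sorry-free and in the importable `Theorems` tree, the complete reduction of
that item to ONE typed statement — the **Weyl budget** for dense normalised gradient shrinkers
on homotopy 4-spheres (`∫|W|² dV < 32π² = 16π²χ`, the registered stub `stub_weylBudget` of the
line `Cruxes/CompactShrinkerGap/Lines/cgy-variance-pivot` of the crux `CompactShrinkerGap`,
stmt-SmoothPoincare4-10870):

* `compactGapOfCGY_diffeomorph_of_weylEnergy_lt` — per datum: under `hCGY : ChangGurskyYang`,
  a closed `M ≃ₕ S⁴` carrying a gradient shrinker `Ric + Hess f = g/2` (Riemannian `g` with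
  Levi-Civita connection, smooth `f`) whose Weyl energy is `< 32π²` is diffeomorphic to `S⁴`:
  `π₁(M) = 1` (PROVED, `simplyConnectedSpace_of_homotopyEquiv_sphere_four` with
  `simplyConnectedSpace_sphere_four_holds`), `R > 0` on a closed shrinker (LANDED,
  `Theorems.stub_scalarCurvaturePos_of_identities`, identity (B) from
  `Theorems.stub_shrinkerScalarIdentities`), and `hCGY` (Chang–Gursky–Yang 2003, Thm. A,
  simply connected case, route decl `ChangGurskyYang`) returns the diffeomorphism;
* `compactGapOfChangGurskyYang_of_weylBudget` — the item follows from the Weyl budget (the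
  hypothesis `hWB` is byte-for-byte the registered signature of `stub_weylBudget`).

So the item closes by `compactGapOfChangGurskyYang_of_weylBudget Theorems.stub_weylBudget` the
moment the Weyl budget lands (and, trivially, by `fun _ ↦ h` from any proof `h` of the crux
`CompactShrinkerGap` along another line). No named fact is a hypothesis of this file; the
normalisation `R + |∇f|² = f` and the density bound are carried but not used by the finisher.

References: S.-Y. A. Chang, M. J. Gursky, P. C. Yang, *A conformally invariant sphere theorem in
four dimensions*, Publ. Math. IHÉS 98 (2003), Thm. A [ChangGurskyYang2003]; H.-D. Cao,
R. Hamilton, T. Ilmanen, *Gaussian densities and stability for some Ricci solitons*,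
arXiv:math/0404165, §4 [CaoHamiltonIlmanen2004].
-/

-- the registered namespace `Summit.SmoothPoincare4.SmoothPoincare4.Theorems` repeats a component
set_option linter.dupNamespace false

noncomputable section

open scoped Manifold ContDiff ENNReal ContinuousMap

namespace Summit.SmoothPoincare4.SmoothPoincare4.Theorems

open Summit.SmoothPoincare4.SmoothPoincare4.Theses.EntropyRung

/-- **The Chang–Gursky–Yang door, per datum.** Under `hCGY : EntropyRung.ChangGurskyYang`
(CGY 2003 Thm. A, simply connected `R > 0` case): a closed `M ≃ₕ S⁴` with a gradient shrinking
soliton structure `Ric + Hess f = g/2` (Riemannian `g` with Levi-Civita connection, smooth `f`)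
and Weyl energy `∫|W|² dV < 32π²` is diffeomorphic to `S⁴` — `π₁(M) = 1` from the homotopy
equivalence, `R > 0` because a closed gradient shrinker has positive scalar curvature
(`stub_scalarCurvaturePos_of_identities`). [cite: ChangGurskyYang2003, Thm. A] -/
theorem compactGapOfCGY_diffeomorph_of_weylEnergy_lt (hCGY : ChangGurskyYang)
    (M : Type) [TopologicalSpace M] [T2Space M] [SecondCountableTopology M]
    [ChartedSpace (EuclideanSpace ℝ (Fin 4)) M] [IsManifold (𝓡 4) ∞ M] [CompactSpace M]
    (e : M ≃ₕ Metric.sphere (0 : EuclideanSpace ℝ (Fin 5)) 1)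
    (g : Literature.Geometry.Lorentzian.PseudoRiemannianMetric (𝓡 4) ∞ (EuclideanSpace ℝ (Fin 4))
      (TangentSpace (𝓡 4) : M → Type _)) [g.HasLeviCivita] (f : M → ℝ) (hg : g.IsRiemannian)
    (hf : ContMDiff (𝓡 4) 𝓘(ℝ, ℝ) ∞ f)
    (hsol : ∀ (x : M) (X Y : TangentSpace (𝓡 4) x),
      g.ricci x X Y + g.hessian f x X Y = (1 / 2 : ℝ) * g.val x X Y)
    (hW : g.weylEnergy < ENNReal.ofReal (32 * Real.pi ^ 2)) :
    Nonempty (M ≃ₘ⟮𝓡 4, 𝓡 4⟯ (Metric.sphere (0 : EuclideanSpace ℝ (Fin 5)) 1)) := by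
  haveI : SimplyConnectedSpace M :=
    Literature.Topology.FourManifolds.simplyConnectedSpace_of_homotopyEquiv_sphere_four
      Literature.Topology.FourManifolds.simplyConnectedSpace_sphere_four_holds M e
  obtain ⟨_, hB⟩ := stub_shrinkerScalarIdentities M g f hg hf hsol
  have hR : ∀ x : M, 0 < g.scalarCurvature x :=
    stub_scalarCurvaturePos_of_identities M g f hg hf hsol hB
  exact hCGY M ⟨g, ‹_›, hg, hR, hW⟩

/-- **Item `CompactGapOfChangGurskyYang` from the Weyl budget.** If every dense normalised
gradient shrinker on a closed homotopy 4-sphere — `Ric + Hess f = g/2`, `R + |∇f|² = f`,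
Gaussian mass `∫ e^{-f} dV > 32π²√π e^{-3/2}` (density above `Θ(S³×ℝ)`) — has Weyl energy
`∫|W|² dV < 32π²` (hypothesis `hWB`, verbatim the registered stub `stub_weylBudget` of line
`cgy-variance-pivot` of crux stmt-SmoothPoincare4-10870), then `ChangGurskyYang → CompactShrinkerGap`.
Unfold both route decls and apply the per-datum door. [cite: ChangGurskyYang2003, Thm. A]
[cite: CaoHamiltonIlmanen2004, §4] -/
theorem compactGapOfChangGurskyYang_of_weylBudget
    (hWB : ∀ (M : Type) [TopologicalSpace M] [T2Space M] [SecondCountableTopology M]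
      [ChartedSpace (EuclideanSpace ℝ (Fin 4)) M] [IsManifold (𝓡 4) ∞ M] [CompactSpace M]
      [T3Space M] [MeasurableSpace M] [BorelSpace M],
      M ≃ₕ Metric.sphere (0 : EuclideanSpace ℝ (Fin 5)) 1 →
    ∀ (g : Literature.Geometry.Lorentzian.PseudoRiemannianMetric (𝓡 4) ∞ (EuclideanSpace ℝ (Fin 4))
        (TangentSpace (𝓡 4) : M → Type _)) [g.HasLeviCivita] (f : M → ℝ) (hg : g.IsRiemannian),
      ContMDiff (𝓡 4) 𝓘(ℝ, ℝ) ∞ f →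
      (∀ (x : M) (X Y : TangentSpace (𝓡 4) x),
        g.ricci x X Y + g.hessian f x X Y = (1 / 2 : ℝ) * g.val x X Y) →
      (∀ x : M, g.scalarCurvature x + g.gradSq f x = f x) →
      ENNReal.ofReal (32 * Real.pi ^ 2 * Real.sqrt Real.pi * Real.exp (-(3 : ℝ) / 2)) <
        ∫⁻ x, ENNReal.ofReal (Real.exp (-f x))
          ∂(Literature.Geometry.Lorentzian.riemannianMeasure (g.toContMDiffRiemannianMetric hg)) →
      g.weylEnergy < ENNReal.ofReal (32 * Real.pi ^ 2)) :
    CompactGapOfChangGurskyYang := by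
  unfold CompactGapOfChangGurskyYang CompactShrinkerGap
  intro hCGY M _ _ _ _ _ _ _ _ _ e g _ f hg hf hsol hnorm hdens
  exact compactGapOfCGY_diffeomorph_of_weylEnergy_lt hCGY M e g f hg hf hsol
    (hWB M e g f hg hf hsol hnorm hdens)

end Summit.SmoothPoincare4.SmoothPoincare4.Theorems

end
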